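/-
Copyright (c) 2026. All rights reserved.
Released under Apache 2.0 license as described in the file LICENSE.
Authors: abc-iut cell, seat abc-iut-L4-t8 (gen 9; L4-lead row «TYPE-CHOL-THPLUS», file 2: the functors
`λ⊞` of [AbsTopIII] Def 5.4 (vi) and `ι⊞_×` of Def 5.4 (v), over `ArchimedeanHolGroupPairs`).
-/
import Literature.AnabelianGeometry.AbsoluteAnabelian.ArchimedeanHolGroupPairs
import HarnessLib

/-!
# [AbsTopIII] Def 5.4 (v)/(vi): the functors `λ⊞ : 𝒞^hol_TF → 𝒞^hol_{TH⊞}` at the vertices of `Γ⃗×_arc`, and `ι⊞_×`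

S. Mochizuki, *Topics in absolute anabelian geometry III*, kurims manuscript (`paper:url-5493eb38cbb7`, read
on the page; bib key `MochizukiAbsTopIII2015`): Def 5.4 (v) p.127 («the diagram `Γ⃗⋉_arc` may be
considered either as a diagram in the category `TH` or as a diagram in `TH⊞`»; `Γ⃗×_arc` is the shell
arrow `k∼ ↠ k×`), Def 5.4 (vi) p.128 («for each vertex `ν` of `Γ⃗×_v`, by assigning to "`k`" … the
object at the vertex `ν` of the diagram of (v), we obtain a natural functor `𝒞^hol_T → 𝒞^hol_{TH⊞}`»),
Def 4.1 (iv) p.104 (`λ^×`, `λ^∼`, `ι_×`).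

Over file 1 (`HolTHPlusPair` = `𝒞^hol_{TH⊞}`) and abc-iut-L4-t10's `lamTimes` / `lamSim` / `iotaTimes`
(`ArchimedeanLogFrobeniusModel`, `T = TF`):

* `unitsPres k : Additive kˣ ≃ₜ k ∖ {0}`, `univPres k : k ≃ₜ k` — the presentations inside the CAF;
* `HolTFPair.lamTimesPlus`, `HolTFPair.lamSimPlus : 𝒞^hol_TF ⥤ 𝒞^hol_{TH⊞}` — `λ⊞` at the vertices
  `mult` (`k^×`, multiplicative group, Kummer homomorphism `κ_k|`) and `pre` (`k∼ = (k,+)`, Kummer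
  homomorphism `κ_k ∘ exp_k`); they lift `λ^×`, `λ^∼` along `𝒞^hol_{TH⊞} → 𝒞^hol_TH` ON THE NOSE
  (`lamTimesPlus_forgetTH`, `lamSimPlus_forgetTH`, both `rfl`);
* `HolTFPair.expHom`, `HolTFPair.iotaTimesPlus : lamSimPlus ⟶ lamTimesPlus` — the shell arrow
  `k∼ ↠ k^×` (`exp_k`) IS a continuous homomorphism `(k,+) → k^×`, so `Γ⃗×_arc` is a diagram in `TH⊞`;
  it lifts `ι_×` on the nose (`iotaTimesPlus_forgetTH`).

Refereed pre-IUT anabelian geometry; a MODEL (kernel definitions) over the interface `AutHolFieldFunctor`;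
no instances, no notation; nothing here bears on [IUTchIII] Cor. 3.12; typed ≠ proved.
-/

set_option autoImplicit false

noncomputable section

namespace Literature.AnabelianGeometry.AbsoluteAnabelian

open _root_.CategoryTheory _root_.Topology

universe u

/-! ### The presentations of `k^×` and `k∼` inside the CAF -/

section Presentations

variable (k : Type u) [NormedField k]

/-- The presentation of `k^×` inside `k`: the units of `k`, written additively, are homeomorphic to
`k ∖ {0}` (inversion is continuous away from `0`). [cite: MochizukiAbsTopIII2015, Definition 4.1 (iv) p.104] -/
def unitsPres : Additive kˣ ≃ₜ (THPlusShape.times.carrier k) where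
  toFun u := ⟨((Additive.toMul u : kˣ) : k), (Additive.toMul u).ne_zero⟩
  invFun x := Additive.ofMul (Units.mk0 x.1 x.2)
  left_inv u := by
    change Additive.ofMul (Units.mk0 ((Additive.toMul u : kˣ) : k) _) = u
    rw [Units.mk0_val]
    rfl
  right_inv x := rfl
  continuous_toFun := (Units.continuous_val.comp continuous_toMul).subtype_mk _
  continuous_invFun := by
    refine continuous_ofMul.comp (Units.continuous_iff.2 ⟨continuous_subtype_val, ?_⟩)
    change Continuous fun x : (THPlusShape.times.carrier k) => ((x : k))⁻¹
    exact continuous_subtype_val.inv₀ fun x => x.2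

/-- The presentation of `k∼ = (k, +)` inside `k` (everything). [cite: MochizukiAbsTopIII2015, Definition 4.1 (iv) p.104] -/
def univPres : k ≃ₜ (THPlusShape.sim.carrier k) where
  toFun x := ⟨x, Set.mem_univ x⟩
  invFun x := x.1
  left_inv _ := rfl
  right_inv _ := rfl
  continuous_toFun := continuous_id.subtype_mk _
  continuous_invFun := continuous_subtype_val

end Presentations

/-! ### Def 5.4 (vi): the functors `λ⊞` — `𝒞^hol_TF → 𝒞^hol_{TH⊞}` at the vertices `mult`, `pre` -/

namespace HolTFPair

variable {𝔄 : AutHolFieldFunctor.{u}}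

/-- `λ⊞` at the vertex `mult` on objects: `(𝕏 ↶ k) ↦ (𝕏 ↶ k^×)` with `k^×` the multiplicative
Aut-holomorphic GROUP and Kummer homomorphism `κ_k|_{k^×}`. [cite: MochizukiAbsTopIII2015, Definition 5.4 (vi) p.128] -/
def lamTimesPlusObj (P : HolTFPair 𝔄) : HolTHPlusPair 𝔄 where
  X := P.X
  k := P.k
  isCAF := P.isCAF
  c := P.κ
  continuous_c := P.continuous_κ
  continuous_c_symm := P.continuous_κ_symm
  shape := .times
  B := Additive P.kˣ
  pres := unitsPres P.k
  pres_add _ _ := rfl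

/-- `λ⊞` at the vertex `pre` on objects: `(𝕏 ↶ k) ↦ (𝕏 ↶ k∼)` with `k∼ = (k, +)` the additive
Aut-holomorphic GROUP and Kummer homomorphism `κ_k ∘ exp_k`. [cite: MochizukiAbsTopIII2015, Definition 5.4 (vi) p.128] -/
def lamSimPlusObj (P : HolTFPair 𝔄) : HolTHPlusPair 𝔄 where
  X := P.X
  k := P.k
  isCAF := P.isCAF
  c := P.κ
  continuous_c := P.continuous_κ
  continuous_c_symm := P.continuous_κ_symm
  shape := .sim
  B := P.k
  pres := univPres P.k
  pres_add _ _ := rfl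

/-- The homomorphism `k₁^× → k₂^×` induced by a continuous field homomorphism, written additively.
[cite: MochizukiAbsTopIII2015, Definition 4.1 (iv) p.104] -/
def unitsMapAdd {P Q : HolTFPair 𝔄} (φ : P ⟶ Q) : Additive P.kˣ →ₜ+ Additive Q.kˣ where
  toFun u := Additive.ofMul (Units.map φ.arith.toMonoidHom (Additive.toMul u))
  map_zero' := by
    change Additive.ofMul (Units.map φ.arith.toMonoidHom 1) = 0
    rw [map_one]
    rfl
  map_add' a b := by
    change Additive.ofMul (Units.map φ.arith.toMonoidHom (Additive.toMul a * Additive.toMul b)) = _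
    rw [map_mul]
    rfl
  continuous_toFun :=
    continuous_ofMul.comp ((Continuous.units_map φ.arith.toMonoidHom φ.continuous_arith).comp
      continuous_toMul)

/-- The arithmetic part `φ_M = κ₂⁻¹ ∘ 𝒜_{φ_𝕏} ∘ κ₁` of a morphism of `TF`-pairs is onto.
[cite: MochizukiAbsTopIII2015, Proposition 4.2 (i) p.105] -/
theorem arith_surjective {P Q : HolTFPair 𝔄} (φ : P ⟶ Q) : Function.Surjective φ.arith := by
  intro y
  refine ⟨P.κ.symm ((𝔄.Amap φ.base).symm (Q.κ y)), Q.κ.injective ?_⟩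
  rw [φ.compat, RingEquiv.apply_symm_apply, RingEquiv.apply_symm_apply]

/-- `φ_M|_{k^×} : k₁^× → k₂^×` is onto. [cite: MochizukiAbsTopIII2015, Definition 5.4 (vi) p.128] -/
theorem unitsMapAdd_surjective {P Q : HolTFPair 𝔄} (φ : P ⟶ Q) : Function.Surjective (unitsMapAdd φ) := by
  intro u
  obtain ⟨m, hm⟩ := arith_surjective φ ((Additive.toMul u : Q.kˣ) : Q.k)
  have hm0 : m ≠ 0 := by
    rintro rfl
    rw [map_zero] at hm
    exact (Additive.toMul u).ne_zero hm.symm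
  refine ⟨Additive.ofMul (Units.mk0 m hm0), ?_⟩
  change Additive.ofMul (Units.map φ.arith.toMonoidHom (Units.mk0 m hm0)) = u
  have : Units.map φ.arith.toMonoidHom (Units.mk0 m hm0) = Additive.toMul u := Units.ext hm
  rw [this]
  rfl

variable (𝔄) in
/-- **Def 5.4 (vi): `λ⊞` at the vertex `mult`, `𝒞^hol_TF → 𝒞^hol_{TH⊞}`**, `(𝕏 ↶ k) ↦ (𝕏 ↶ k^×)`; on
morphisms `φ_M ↦ φ_M|_{k^×}` (a homomorphism of the multiplicative groups).
[cite: MochizukiAbsTopIII2015, Definition 5.4 (vi) p.128] -/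
def lamTimesPlus : HolTFPair 𝔄 ⥤ HolTHPlusPair 𝔄 where
  obj := lamTimesPlusObj
  map {P Q} φ :=
    { base := φ.base
      arith := unitsMapAdd φ
      surj := unitsMapAdd_surjective φ
      compat := fun u => φ.compat _
      hol := fun e he he' => ((lamTimes 𝔄).map φ).hol e he he' }
  map_id P := by
    apply HolTHPlusPair.Hom.ext
    · rfl
    · exact ContinuousAddMonoidHom.ext fun u => rfl
  map_comp φ ψ := by
    apply HolTHPlusPair.Hom.ext
    · rfl
    · exact ContinuousAddMonoidHom.ext fun u => rfl

variable (𝔄) in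
/-- **Def 5.4 (vi): `λ⊞` at the vertex `pre`, `𝒞^hol_TF → 𝒞^hol_{TH⊞}`**, `(𝕏 ↶ k) ↦ (𝕏 ↶ k∼)`; on
morphisms `φ_M` itself (a homomorphism of the additive groups, compatible with the Kummer homomorphisms
`κ ∘ exp` because continuous field homomorphisms commute with `exp`).
[cite: MochizukiAbsTopIII2015, Definition 5.4 (vi) p.128] -/
def lamSimPlus : HolTFPair 𝔄 ⥤ HolTHPlusPair 𝔄 where
  obj := lamSimPlusObj
  map {P Q} φ :=
    { base := φ.base
      arith := ⟨φ.arith.toAddMonoidHom, φ.continuous_arith⟩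
      surj := arith_surjective φ
      compat := fun b => by
        haveI := P.charZero_k
        haveI := Q.charZero_k
        change Q.κ (univCover Q.k (φ.arith b)) = 𝔄.Amap φ.base (P.κ (univCover P.k b))
        rw [← P.isCAF.map_univCover φ.arith φ.continuous_arith, φ.compat]
      hol := fun e he he' => ((lamSim 𝔄).map φ).hol e he he' }
  map_id P := by apply HolTHPlusPair.Hom.ext <;> rfl
  map_comp φ ψ := by apply HolTHPlusPair.Hom.ext <;> rfl

/-- **`λ⊞` lifts `λ^×` ON THE NOSE**: `λ⊞_mult ⋙ (𝒞^hol_{TH⊞} → 𝒞^hol_TH) = λ^×`.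
[cite: MochizukiAbsTopIII2015, Definition 5.4 (vi) p.128] -/
theorem lamTimesPlus_forgetTH : lamTimesPlus 𝔄 ⋙ HolTHPlusPair.forgetTH 𝔄 = lamTimes 𝔄 := rfl

/-- **`λ⊞` lifts `λ^∼` ON THE NOSE**: `λ⊞_pre ⋙ (𝒞^hol_{TH⊞} → 𝒞^hol_TH) = λ^∼`.
[cite: MochizukiAbsTopIII2015, Definition 5.4 (vi) p.128] -/
theorem lamSimPlus_forgetTH : lamSimPlus 𝔄 ⋙ HolTHPlusPair.forgetTH 𝔄 = lamSim 𝔄 := rfl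

/-- The structure-orbispace of `λ⊞_mult (𝕏 ↶ k)` is `𝕏`. [cite: MochizukiAbsTopIII2015, Definition 5.4 (vi) p.128] -/
theorem lamTimesPlus_toEA : lamTimesPlus 𝔄 ⋙ HolTHPlusPair.toEA 𝔄 = toEA 𝔄 := rfl

/-- The structure-orbispace of `λ⊞_pre (𝕏 ↶ k)` is `𝕏`. [cite: MochizukiAbsTopIII2015, Definition 5.4 (vi) p.128] -/
theorem lamSimPlus_toEA : lamSimPlus 𝔄 ⋙ HolTHPlusPair.toEA 𝔄 = toEA 𝔄 := rfl

/-! ### Def 5.4 (v): `Γ⃗×_arc = (k∼ ↠ k^×)` as a diagram in `TH⊞` -/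

/-- **The shell arrow `k∼ ↠ k^×` is a HOMOMORPHISM** `(k, +) → k^×` (continuous): `exp_k`, written into the
additive presentation of `k^×`. [cite: MochizukiAbsTopIII2015, Definition 5.4 (v) p.127] -/
def expHom (P : HolTFPair 𝔄) : P.k →ₜ+ Additive P.kˣ :=
  haveI := P.charZero_k
  { toFun := fun x => Additive.ofMul (Units.mk0 (univCover P.k x) (IsCAF.univCover_ne_zero P.isCAF x))
    map_zero' := by
      apply congrArg Additive.ofMul
      exact Units.ext (IsCAF.univCover_zero P.isCAF)
    map_add' := fun x y => by
      apply congrArg Additive.ofMul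
      exact Units.ext (IsCAF.univCover_add P.isCAF x y)
    continuous_toFun := by
      refine continuous_ofMul.comp (Units.continuous_iff.2 ⟨IsCAF.continuous_univCover P.isCAF, ?_⟩)
      change Continuous fun x => (univCover P.k x)⁻¹
      exact (IsCAF.continuous_univCover P.isCAF).inv₀ (IsCAF.univCover_ne_zero P.isCAF) }

/-- `exp_k : k → k^×` is onto («`k∼ ↠ k^×`»). [cite: MochizukiAbsTopIII2015, Definition 5.4 (v) p.127] -/
theorem expHom_surjective (P : HolTFPair 𝔄) : Function.Surjective (expHom P) := by
  intro u
  haveI := P.charZero_k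
  obtain ⟨x, hx⟩ := IsCAF.univCover_surjective_units P.isCAF (Additive.toMul u)
  refine ⟨x, ?_⟩
  change Additive.ofMul (Units.mk0 (univCover P.k x) _) = u
  have : Units.mk0 (univCover P.k x) (IsCAF.univCover_ne_zero P.isCAF x) = Additive.toMul u :=
    Units.ext hx
  rw [this]
  rfl

/-- **`ι⊞_×` at a pair**: `λ⊞_pre (𝕏 ↶ k) = (𝕏 ↶ k∼) → (𝕏 ↶ k^×) = λ⊞_mult (𝕏 ↶ k)`, the shell arrow
`k∼ ↠ k^×` as a morphism of `𝒞^hol_{TH⊞}` (a homomorphism compatible with the Kummer homomorphisms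
`κ ∘ exp` and `κ`, holomorphic in the charts — it lifts `iotaTimes`).
[cite: MochizukiAbsTopIII2015, Definition 5.4 (v) p.127] -/
def iotaTimesPlusApp (P : HolTFPair 𝔄) : (lamSimPlus 𝔄).obj P ⟶ (lamTimesPlus 𝔄).obj P where
  base := 𝟙 P.X
  arith := expHom P
  surj := expHom_surjective P
  compat b := by
    haveI := P.charZero_k
    change P.κ (univCover P.k b) = 𝔄.Amap (𝟙 P.X) (P.κ (univCover P.k b))
    rw [𝔄.Amap_id_apply]
  hol e he he' := (iotaTimesApp P).hol e he he'

variable (𝔄) in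
/-- **`ι⊞_× : λ⊞_pre → λ⊞_mult`** — `Γ⃗×_arc = (k∼ ↠ k^×)` «as a diagram in `TH⊞`» (Def 5.4 (v)), natural in
the pair because continuous field homomorphisms commute with `exp`.
[cite: MochizukiAbsTopIII2015, Definition 5.4 (v) p.127] -/
def iotaTimesPlus : lamSimPlus 𝔄 ⟶ lamTimesPlus 𝔄 where
  app := iotaTimesPlusApp
  naturality P Q φ := by
    apply HolTHPlusPair.Hom.ext
    · change φ.base ≫ 𝟙 Q.X = 𝟙 P.X ≫ φ.base
      rw [Category.comp_id, Category.id_comp]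
    · apply ContinuousAddMonoidHom.ext
      intro x
      haveI := P.charZero_k
      haveI := Q.charZero_k
      apply congrArg Additive.ofMul
      apply Units.ext
      change univCover Q.k (φ.arith x) = φ.arith (univCover P.k x)
      exact (P.isCAF.map_univCover φ.arith φ.continuous_arith x).symm

/-- `ι⊞_×` lifts `ι_×` ON THE NOSE along `𝒞^hol_{TH⊞} → 𝒞^hol_TH`.
[cite: MochizukiAbsTopIII2015, Definition 5.4 (v) p.127] -/
theorem iotaTimesPlus_forgetTH (P : HolTFPair 𝔄) :
    (HolTHPlusPair.forgetTH 𝔄).map ((iotaTimesPlus 𝔄).app P) = (iotaTimes 𝔄).app P := rfl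

end HolTFPair

end Literature.AnabelianGeometry.AbsoluteAnabelian

end
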